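import Summits.AtomisticToContinuum.Crystallization.Theorems.LoopTunnelDialSieveCurrency

/-!
# LoopTunnelDial — the CONTACT LAW `ContactHot ρ b` and the separation dial `MinSepGS ρ` (lens-5 generation 18; helper vocabulary of crux `PocketCase`, stmt-AtomisticToContinuum-27294)

Landing kit file 2/5.  `ForceBalancedAt y k` (net Lennard-Jones force on `k` vanishes — verbatim the conclusion of the tree's
`forceBalance_sum_deriv_eq_zero`); the ground-state-free CONTACT LAW `ContactHot ρ b` (a force-balanced particle of an injective
`7/10`-separated configuration with a neighbour closer than `ρ` has site energy `≥ b`), its GS form, monotonicity in both dials, RUNG 0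
(`ρ ≤ 7/10`, the tree's separation constant), HOT `ContactHotAbove ρ := ∃ b > e⋆, ContactHot ρ b` (preview stub 3 at `ρ = 3/4`);
`MinSepGS ρ` and THE SECOND THRESHOLD: a contact law with floor `> −1/12` makes every Lennard-Jones ground state `ρ`-separated
(`minSepGS_of_contactHot`), with `ContactHotGS ρ b ⟺ MinSepGS ρ` for `b > −1/12`.  All `[folklore]`; 0 sorry.
-/

noncomputable section

open scoped BigOperators Classical InnerProductSpace
open Literature.MathematicalPhysics.StatisticalMechanics
open Literature.MathematicalPhysics.StatisticalMechanics.Yuhjtman2015 (hLJ)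
open Summit.AtomisticToContinuum.Crystallization.Theorems.GrainPercolationDialCrossCeiling (E3 ballChunk)
open Summit.AtomisticToContinuum.Crystallization.Theorems.ChargedEnergyGapNegative (eStar)
open Summit.AtomisticToContinuum.Crystallization.Theorems.LjLaminarWindowsSketch
  (lennardJones_groundState_dist_ge_seven_tenths forceBalance_sum_deriv_eq_zero forceBalance_one_le_sum_hLJ hLJ' kF)
open Summit.AtomisticToContinuum.Crystallization.Theorems.LoopTunnelDialLocalSurgery (improvable_mono)
open Summit.AtomisticToContinuum.Crystallization.Theorems.LoopTunnelDialSieveCurrency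

namespace Summit.AtomisticToContinuum.Crystallization.Theorems.LoopTunnelDialContactLaw

variable {N : ℕ}


/-- `ForceBalancedAt y k` — the NET LENNARD-JONES FORCE on particle `k` VANISHES: for every vector `e`,
`∑_{m ≠ k} V′(r_{km}) · ⟪y_k − y_m, e⟫ / r_{km} = 0` with `V′(r) = −(1/12)(12 r⁻¹³ − 12 r⁻⁷)` — verbatim the conclusion of the tree's
`LjLaminarWindowsSketch.forceBalance_sum_deriv_eq_zero`, which proves it for EVERY particle of EVERY ground state (Fermat, first variation). [line vocabulary · LoopTunnelDial contact dial · crux stmt-AtomisticToContinuum-27294 · definition, not a cited fact] -/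
def ForceBalancedAt {N : ℕ} (y : Fin N → E3) (k : Fin N) : Prop :=
  ∀ e : E3, ∑ m ∈ Finset.univ.erase k,
      -(1 / 12) * (12 * (dist (y k) (y m))⁻¹ ^ 13 - 12 * (dist (y k) (y m))⁻¹ ^ 7) * (⟪y k - y m, e⟫_ℝ / dist (y k) (y m)) = 0

/-- Ground states are force-balanced at every particle (tree). -/
theorem forceBalancedAt_of_isGroundState {y : Fin N → E3} (hy : IsGroundState lennardJones y) (k : Fin N) : ForceBalancedAt y k :=
  fun e => forceBalance_sum_deriv_eq_zero hy k e

/-- **THE CONTACT LAW `ContactHot ρ b`** — GS-free · `μ`-free · `e⋆`-free · `N`-free · no `E(N ± k)` · decidable per specimen: in every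
injective `7/10`-separated finite configuration of `ℝ³`, a FORCE-BALANCED particle having a neighbour CLOSER than `ρ` has site energy `≥ b`.
Heuristic (card): at `ρ = 3/4` the repulsion `|V′(3/4)| ≈ 34.7` of the short bond can only be balanced by further REPULSIVE contacts in the
opposite hemisphere (the attractive pull of all matter beyond `1` is `≲ 5`), whose angular packing at mutual distance `≥ 7/10` caps `∑ cos θ ≲ 4`
(Tammes), forcing contacts at `r ≲ 0.84` costing `≳ 1.3` on top of `V(3/4) ≈ 1.69`, against an attractive capacity `≲ 3.2`: expected floor
`Φ(3/4) ≈ +0.2 … +1`, margins `≈ 1` above `e⋆ ≈ −0.72` and `≈ 0.3 … 1` above `−1/12`. [UNDECIDED (stated test) · INSTRUMENTABLE · two dials] [line vocabulary · LoopTunnelDial contact dial · crux stmt-AtomisticToContinuum-27294 · definition, not a cited fact] -/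
def ContactHot (ρ b : ℝ) : Prop :=
  ∀ (N : ℕ) (y : Fin N → E3), Function.Injective y → (∀ i j : Fin N, i ≠ j → (7 : ℝ) / 10 ≤ dist (y i) (y j)) →
    ∀ k l : Fin N, k ≠ l → dist (y k) (y l) < ρ → ForceBalancedAt y k → b ≤ siteEnergy lennardJones y k

/-- The GROUND-STATE form of the contact law (what the door consumes). [line vocabulary · LoopTunnelDial contact dial · crux stmt-AtomisticToContinuum-27294 · definition, not a cited fact] -/
def ContactHotGS (ρ b : ℝ) : Prop :=
  ∀ (N : ℕ) (y : Fin N → E3), IsGroundState lennardJones y →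
    ∀ k l : Fin N, k ≠ l → dist (y k) (y l) < ρ → b ≤ siteEnergy lennardJones y k

/-- Law ⟹ GS form (ground states are injective, `7/10`-separated and force-balanced — three tree facts). -/
theorem contactHotGS_of_contactHot {ρ b : ℝ} (h : ContactHot ρ b) : ContactHotGS ρ b :=
  fun N y hy k l hkl hd =>
    h N y hy.1 (fun _ _ hij => lennardJones_groundState_dist_ge_seven_tenths hy hij) k l hkl hd (forceBalancedAt_of_isGroundState hy k)

/-- The two dials are monotone: a smaller contact radius and a lower floor are weaker. -/
theorem contactHot_mono {ρ ρ' b b' : ℝ} (hρ : ρ' ≤ ρ) (hb : b' ≤ b) (h : ContactHot ρ b) : ContactHot ρ' b' :=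
  fun N y hy hsep k l hkl hd hF => hb.trans (h N y hy hsep k l hkl (lt_of_lt_of_le hd hρ) hF)

/-- The GS contact law is monotone in both dials. [folklore] -/
theorem contactHotGS_mono {ρ ρ' b b' : ℝ} (hρ : ρ' ≤ ρ) (hb : b' ≤ b) (h : ContactHotGS ρ b) : ContactHotGS ρ' b' :=
  fun N y hy k l hkl hd => hb.trans (h N y hy k l hkl (lt_of_lt_of_le hd hρ))

/-- **RUNG 0 (PROVED, vacuous).** Up to the tree's separation constant `7/10` the contact law holds at EVERY floor. -/
theorem contactHot_of_le_seven_tenths {ρ : ℝ} (hρ : ρ ≤ 7 / 10) (b : ℝ) : ContactHot ρ b :=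
  fun _ _ _ hsep k l hkl hd _ => absurd (lt_of_lt_of_le hd hρ) (not_lt.2 (hsep k l hkl))

/-- **HOT `ContactHotAbove ρ`** — the contact law at SOME floor above the bulk level `e⋆` (no hand-picked floor). [PREVIEW STUB 3 at `ρ = 3/4`] [line vocabulary · LoopTunnelDial contact dial · crux stmt-AtomisticToContinuum-27294 · definition, not a cited fact] -/
def ContactHotAbove (ρ : ℝ) : Prop := ∃ b : ℝ, eStar < b ∧ ContactHot ρ b

/-- A law at a floor above `e⋆` gives HOT. [folklore] -/
theorem contactHotAbove_of_lt {ρ b : ℝ} (he : eStar < b) (h : ContactHot ρ b) : ContactHotAbove ρ := ⟨b, he, h⟩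

/-- The NUMERIC INSTRUMENT suffices: `ContactHot (3/4) (−7/10)` and the landed `OnePercentFccRung.eStar_le_neg : e⋆ ≤ −0.711`
(module hub-unbuilt on 2026-08-30, hence a hypothesis here) give HOT. -/
theorem contactHotAbove_of_threeQuarters (h : ContactHot (3 / 4) (-(7 / 10))) (he : eStar ≤ -(711 / 1000)) :
    ContactHotAbove (3 / 4) :=
  ⟨-(7 / 10), by linarith, h⟩

/-- HOT is monotone in the radius. [folklore] -/
theorem contactHotAbove_mono {ρ ρ' : ℝ} (hρ : ρ' ≤ ρ) (h : ContactHotAbove ρ) : ContactHotAbove ρ' := by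
  obtain ⟨b, hb, h⟩ := h
  exact ⟨b, hb, contactHot_mono hρ le_rfl h⟩

/-- **`MinSepGS ρ`** — every Lennard-Jones ground state in `ℝ³` is `ρ`-SEPARATED.  Tree: `ρ = 7/10`
(`LjLaminarWindowsSketch.lennardJones_groundState_dist_ge_seven_tenths`, sharpening the published `0.684` [Yuhjtman 2015]); open in print
above that; expected true up to `ρ ≈ 0.97·2^{-1/6}` [Kiessling–Wales 2025, arXiv:2511.15008, p. 4: «presumably `r_min ≥ σ`»]. [line vocabulary · LoopTunnelDial contact dial · crux stmt-AtomisticToContinuum-27294 · definition, not a cited fact] -/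
def MinSepGS (ρ : ℝ) : Prop :=
  ∀ (N : ℕ) (y : Fin N → E3), IsGroundState lennardJones y → ∀ k l : Fin N, k ≠ l → ρ ≤ dist (y k) (y l)

/-- The tree's separation constant: `MinSepGS (7/10)`. [folklore] -/
theorem minSepGS_seven_tenths : MinSepGS (7 / 10) :=
  fun _ _ hy _ _ hkl => lennardJones_groundState_dist_ge_seven_tenths hy hkl

/-- `MinSepGS` is antitone in the radius. [folklore] -/
theorem minSepGS_anti {ρ ρ' : ℝ} (hρ : ρ' ≤ ρ) (h : MinSepGS ρ) : MinSepGS ρ' :=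
  fun N y hy k l hkl => hρ.trans (h N y hy k l hkl)

/-- The site energy of a particle of a ground state with `N ≥ 2` is at most `−1/12` (removal + re-insertion next to an extreme particle;
tree `forceBalance_one_le_sum_hLJ`). -/
theorem siteEnergy_le_of_isGroundState {y : Fin N → E3} (hy : IsGroundState lennardJones y) {k l : Fin N} (hkl : k ≠ l) :
    siteEnergy lennardJones y k ≤ -(1 / 12) := by
  have h2 := forceBalance_one_le_sum_hLJ hy hkl
  have h3 : siteEnergy lennardJones y k = -(1 / 12) * ∑ m ∈ Finset.univ.erase k, hLJ (dist (y k) (y m)) := by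
    simp only [siteEnergy, lennardJones_eq_hLJ, Finset.mul_sum]
  rw [h3]
  linarith

/-- **THE SECOND THRESHOLD OF THE DIAL (PROVED).** A GS contact law with floor above `−1/12` RAISES THE SEPARATION CONSTANT of
Lennard-Jones ground states to `ρ`. -/
theorem minSepGS_of_contactHotGS {ρ b : ℝ} (hb : -(1 / 12) < b) (h : ContactHotGS ρ b) : MinSepGS ρ := by
  intro N y hy k l hkl
  by_contra hlt
  rw [not_le] at hlt
  have h1 := h N y hy k l hkl hlt
  have h2 := siteEnergy_le_of_isGroundState hy hkl
  linarith

/-- The second threshold from the GS-free law. [folklore] -/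
theorem minSepGS_of_contactHot {ρ b : ℝ} (hb : -(1 / 12) < b) (h : ContactHot ρ b) : MinSepGS ρ :=
  minSepGS_of_contactHotGS hb (contactHotGS_of_contactHot h)

/-- Conversely `MinSepGS ρ` makes the GS contact law trivial at every floor (no contact below `ρ`). -/
theorem contactHotGS_of_minSepGS {ρ : ℝ} (h : MinSepGS ρ) (b : ℝ) : ContactHotGS ρ b :=
  fun N y hy k l hkl hd => absurd hd (not_lt.2 (h N y hy k l hkl))

/-- At the GS level the second threshold IS the separation constant (PROVED): for `b > −1/12`, `ContactHotGS ρ b ⟺ MinSepGS ρ`. -/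
theorem contactHotGS_iff_minSepGS {ρ b : ℝ} (hb : -(1 / 12) < b) : ContactHotGS ρ b ↔ MinSepGS ρ :=
  ⟨minSepGS_of_contactHotGS hb, fun h => contactHotGS_of_minSepGS h b⟩

end Summit.AtomisticToContinuum.Crystallization.Theorems.LoopTunnelDialContactLaw

end
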